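import Literature.NumberTheory.Automorphic.ReciprocityGLnProofs
import Literature.NumberTheory.Automorphic.AdicCompletionLocalField
import Literature.NumberTheory.GaloisRepresentations.LabelledHodgeTateWeights
import Literature.NumberTheory.GaloisRepresentations.PstCrystallineExtensionData
import Literature.NumberTheory.GaloisRepresentations.ResidualGaloisRep
import Literature.NumberTheory.GaloisRepresentations.AbsGaloisGroup
import Literature.NumberTheory.PAdicHodge.FontaineDpst
import HarnessLib

/-!
# Potential automorphy of a single odd, essentially self-dual, regular, potentially diagonalizable
# `l`-adic representation over a totally real field (Barnet-Lamb–Gee–Geraghty–Taylor 2014, Theorem C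
# of the Introduction = Corollary 4.5.2 / Theorem 4.5.1 of the body)

Topic `Literature/NumberTheory/Automorphic`; sibling of `PDAutomorphyLiftingGL2TotallyReal`
(`BLGGT2014_thm421_GL2_totallyReal`, Thm. 4.2.1 ibid. over totally real fields, whose binders for
"potentially diagonalizable at `v ∣ l` over Fontaine's pinned datum" are followed symbol for symbol),
of `PDAutomorphyLiftingGL4Rational` (`BLGGT2014_thm421_rat_GL4`) and of
`PotentialAutomorphyCompatibleSystemGL4Rational` (`BLGGT2014_thm551_compatibleSystem_rat_GL4`, the
compatible-system half of the same printed Theorem C, which records in its docstring that the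
potential-automorphy half "is NOT here").  The CONCLUSION is phrased in the vocabulary of
`ReciprocityGLnProofs` / `CaraianiLeHungComplexConjugation` / `Qian2022PotentialAutomorphy`
(`CuspidalAutomorphicRepData`, `AutomorphicRepData.IsRegularAlgebraic`,
`HarrisLanTaylorThorne2016.IsCompatible`, `restrictField`), so that it is consumed verbatim by the
accepted named fact `CaraianiLeHung2016_thm_1_1` (image of complex conjugation).  Wanted by the crux
`stmt-Langlands-17009` (`Summit.Langlands.Langlands.Theses.NonParallelVoid.TensorSquareParallel`, line
`merged`, stub `stub_traceComplexConjugation`: `F = ℚ`, `n = 4`, `GO₄` with totally even multiplier)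
and by `stmt-Langlands-17000`.  One NAMED FACT (D-0014), `BLGGT2014_thmC_potentialAutomorphy`, and its
proved projection `BLGGT2014_thmC_potentialAutomorphy.rat_GO_even` onto the shape of that stub.

## The printed statements (held text arXiv:1010.2561 = Ann. of Math. 179 (2014) 501–609, read 2026-08-17)

T. Barnet-Lamb, T. Gee, D. Geraghty, R. Taylor, *Potential automorphy and change of weight*
[BarnetlambEtAl2014].  NUMBERING: the Introduction of the held arXiv text numbers its theorems
1–4 (the lettered Theorems A–D of the published Introduction); the theorem below is **Theorem C =
"Theorem 3" of the held text (p. 4)**, the potential automorphy theorem "for a single `l`-adic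
representation", proved in the body as **Corollary 4.5.2** (p. 30, from **Theorem 4.5.1**, pp. 30–31):
"(See Corollary (mtpmtotreal) and Theorem (incompsyst).)" — the sibling
`PotentialAutomorphyCompatibleSystemGL4Rational` refers to it by the same name ("Cor. 4.5.2; Theorem C
of the Introduction").

* **Theorem C** (held text p. 4), verbatim: "Suppose that `F` is a totally real field. Let `n` be a
  positive integer and let `l ≥ 2(n+1)` be a prime. Let `r : G_F → GL_n(ℚ̄_l)` be a continuous
  representation. We will write `r̄` for the semi-simplification of the reduction of `r`. Suppose
  that the following conditions are satisfied. (1) (Being unramified almost everywhere) `r` is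
  unramified at all but finitely many primes. (2) (Odd essential self-duality) Either `r` maps to
  `GSp_n` with totally odd multiplier or it maps to `GO(n)` with totally even multiplier.
  (3) (Potential diagonalizability and regularity) `r` is potentially diagonalizable (and hence
  potentially crystalline) at each prime `v` of `F` above `l` and for each `τ : F ↪ ℚ̄_l` it has `n`
  distinct `τ`-Hodge–Tate numbers. (4) (Irreducibility) `r̄|_{G_{F(ζ_l)}}` is irreducible. Then we
  can find a finite Galois totally real extension `F'/F` such that `r|_{G_{F'}}` is automorphic.
  Moreover `r` is part of a weakly compatible system of `l`-adic representations."
* **Corollary 4.5.2** (p. 30), verbatim: "Suppose `F⁺` is a totally real field and `n ∈ ℤ_{≥1}`.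
  Suppose that `l ≥ 2(n+1)` is a rational prime. Suppose also that `r : G_{F⁺} → GL_n(ℚ̄_l)` is an
  continuous representation and that `μ : G_{F⁺} → ℚ̄_l^×` is a continuous character. Let `r̄` denote
  the semi-simplification of the reduction of `r`. Suppose that the following conditions hold.
  • (Being unramified almost everywhere) … • (Odd essential self-duality) `(r, μ)` is totally odd,
  essentially conjugate self-dual. • (Potential diagonalizability and regularity at primes above
  `l`) `r` is potentially diagonalizable (and hence potentially crystalline) at each prime `v` of
  `F⁺` above `l` and for each `τ : F ↪ ℚ̄_l` the multiset `HT_τ(r)` contains `n` distinct elements.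
  • (Irreducibility) `r̄|_{G_{F⁺(ζ_l)}}` is irreducible. Then there is a Galois totally real extension
  `F^{+,'}/F⁺` such that `(r|_{G_{F^{+,'}}}, μ|_{G_{F^{+,'}}})` is automorphic of level prime to `l`."
  (Proof in print: a totally imaginary quadratic `F/F⁺` split above `l` and linearly disjoint from
  `(F̄⁺)^{ker ad r̄}(ζ_l)`, Theorem 4.5.1 over `F`, and descent by [BLGHT] Lemma 1.5.)
* **§2.1, Terminology** (pp. 17–18), verbatim: "Continue to fix a rational prime `l` and an
  isomorphism `ı : ℚ̄_l ≅ ℂ`."  "If `F` is totally real then `(r, μ)` is essentially conjugate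
  self-dual if and only if `r` factors through `GSp_n(ℚ̄_l)` (if `μ(c_v) = −ε_v`) or `GO_n(ℚ̄_l)` (if
  `μ(c_v) = ε_v`) with multiplier `μ`."  "We will call `(r, μ)` … totally odd, essentially conjugate
  self-dual if they are essentially conjugate self-dual and `ε_v = 1` for all `v ∣ ∞`."  A RAESDC
  representation of `GL_n(𝔸_F)` (`F` totally real) is a pair `(π, χ)`, "`π` is a cuspidal
  automorphic representation of `GL_n(𝔸_F)` such that `π_∞` has the same infinitesimal character as
  some irreducible algebraic representation of the restriction of scalars from `F` to `ℚ` of `GL_n`",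
  `χ_v(−1)` independent of `v ∣ ∞`, `π ≅ π^∨ ⊗ (χ ∘ det)`.  "We recall that to a RAESDC or RAECSDC
  representation `(π, χ)` of `GL_n(𝔸_F)` we can attach a continuous semi-simple representation
  `r_{l,ı}(π) : G_F → GL_n(ℚ̄_l)` … If `v ∤ l` then Caraiani's local-global compatibility tells us
  that `ı WD(r_{l,ı}(π)|_{G_{F_v}})^{F-ss} ≅ rec(π_v ⊗ |det|_v^{(1−n)/2})`."  "We will call a pair
  `(r, μ)` … automorphic if there is a RAESDC or RAECSDC representation `(π, χ)` such that
  `(r, μ) ≅ (r_{l,ı}(π), r_{l,ı}(χ) ε_l^{1−n})`."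
* **Notation** (p. 6): "if `τ : K ↪ ℚ̄_p` is a continuous embedding of fields then we will write
  `HT_τ(ρ)` for the multiset of Hodge–Tate numbers of `ρ` with respect to `τ`"; "`HT_τ(ε_l) = {−1}`";
  "if `v` is real then we will let `[c_v]` denote the conjugacy class in `G_K` consisting of complex
  conjugations associated to `v`".
* **§1.4** (pp. 13–15): potential diagonalizability (the tree's `IsPotentiallyDiagonalizable`,
  file `GaloisRepresentations/PotentialDiagonalizability`), Lemma 1.4.1 (independence of the
  lattice), Lemma 1.4.3 (ordinary ⇒ PD; Fontaine–Laffaille ⇒ PD).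

## Rendering in the tree's vocabulary (read before reviewing), hypothesis by hypothesis

Binders: `F : Type` a number field with `IsTotallyReal F` (Mathlib); `0 < n`; `l` prime with
`2 * (n + 1) ≤ l`; `ι : ℚ̄_l ≃+* ℂ` — §2.1 fixes an ARBITRARY `ı` before "automorphic" is defined and
Theorem 4.5.1 lists "choose `ı_i : ℚ̄_{l_i} ≅ ℂ`" among its data, so the printed theorem holds for
every `ı` (the extension `F'` may depend on it: `ι` is bound before the conclusion);
`r : Γ_F →ₜ* GL_n(ℚ̄_l)` continuous (`FramedGaloisRep`).

* **(1) unramified almost everywhere** — `∀ᶠ v in cofinite, r.IsUnramifiedAt v`, as in every sibling.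
* **(2) odd essential self-duality** — the disjunction, written out on matrices exactly as the
  accepted `FramedGaloisRep.IsSymplecticWithMultiplierFun` unfolds (`SymplecticMultiplier`) and as
  the requesting stub spells its `GO₄` clause: EITHER there are `J ∈ M_n(ℚ̄_l)` with `Jᵀ = −J`,
  `det J` a unit, and a character `μ : Γ_F →* ℚ̄_l^×` with `r(g)ᵀ J r(g) = μ(g) J` for all `g` and
  `μ(c) = −1` for every complex conjugation `c ∈ Γ_F` ("`r` maps to `GSp_n` with totally odd
  multiplier": `μ(c_v) = −ε_v` with `ε_v = 1` for all `v ∣ ∞`), OR the same with `Jᵀ = J`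
  (`Matrix.IsSymm`) and `μ(c) = 1` ("maps to `GO(n)` with totally even multiplier": `μ(c_v) = ε_v = 1`).
  "Complex conjugation" is the accepted `IsComplexConjugation φ c` for a real embedding `φ : F →+* ℝ`
  (file `AbsGaloisGroup`; all real places, all members of the class `[c_v]`).  The multiplier is
  typed as a bare homomorphism: continuity is automatic, since `μ(g) = (r(g)ᵀ J r(g) J⁻¹)_{11}` is a
  continuous function of `g` (`n ≥ 1`, `J` invertible), so this is the printed "continuous character".
* **(3) potential diagonalizability and regularity at `v ∣ l`** — for every place `v ∣ l` of `F` and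
  Fontaine's PINNED datum `D = fontainePstAdicCompletion v l hv` (`PAdicHodge/FontaineDpst`, the datum
  of the summit `Langlands`): `r|_{Γ_{F_v}}` is de Rham for `D` (`IsDeRhamFramed` — in print this is
  implied by potential diagonalizability, "and hence potentially crystalline", Berger: potentially
  crystalline ⇒ de Rham; it is stated so that the next clause reads genuine Hodge–Tate numbers); for
  every `ℚ_l`-algebra label `τ : F_v → ℚ̄_l` (the idiom of the siblings; the printed labels
  `τ : F ↪ ℚ̄_l` are the pairs `(v, τ_v)`) the multiset `M = r.labelledHodgeTateWeightsAt v D.algebra D.𝔅 τ`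
  (relative to `D.𝔅 = B_dR(F_v)`, convention `HT_τ(ε_l) = {−1}` on both sides) is multiplicity-free
  of cardinality `n` ("`HT_τ(r)` contains `n` distinct elements"); and `r|_{Γ_{F_v}}` is POTENTIALLY
  DIAGONALIZABLE relative to EVERY instance `𝔈` of compatible crystalline extension data over `D`
  (`IsPotentiallyDiagonalizable 𝔈.𝔅 (r.toLocal v)`, BLGGT §1.4, accepted `PotentialDiagonalizability`
  and `PstCrystallineExtensionData`; the genuine instance is Fontaine's tower `K' ↦ B_cris(K')`),
  together with `Nonempty (PstCrystallineExtensionData D)` so that the clause is never vacuous — this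
  is VERBATIM the clause of the accepted `BLGGT2014_thm421_GL2_totallyReal` (existence of the genuine
  instance over the pinned datum is the accepted
  `nonempty_pstCrystallineExtensionData_fontainePstAdicCompletion`, clause (F10) of
  `FontaineDatumExists`).
* **(4) irreducibility of `r̄|_{G_{F(ζ_l)}}`** — `r̄` is the semisimplified reduction over
  `ℤ̄_l/𝔪 ≅ 𝔽̄_l`, so "irreducible" is absolute irreducibility; rendered by the accepted
  `FramedGaloisRep.IsResiduallyAbsIrreducible` (file `ResidualGaloisRep`: SOME reduction over `ℤ̄_l/𝔪`
  is absolutely irreducible) of the restriction `r.restrictField (CyclotomicField l F)` to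
  `Γ_{F(ζ_l)}` (along the chosen `F̄ → \overline{F(ζ_l)}`, well defined up to conjugation, under which
  the clause is invariant).  Equivalence with print: a reduction of `r` restricted to the normal
  subgroup `Γ_{F(ζ_l)}` is a reduction of `r|_{Γ_{F(ζ_l)}}` with semisimplification `r̄|_{Γ_{F(ζ_l)}}`
  (Clifford: `r̄|` is semisimple; Brauer–Nesbitt), and a representation whose semisimplification is
  irreducible is itself irreducible; conversely an absolutely irreducible reduction is its own
  semisimplification.  This is the clause of the requesting line, symbol for symbol.
  `2(n+1) ≤ l` is printed; `ζ_l ∉ F` is automatic (`F` totally real, `l > 2`).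
* **CONCLUSION** — "a finite Galois totally real extension `F'/F` such that `r|_{G_{F'}}` is
  automorphic": a number field `F'` with `Algebra F F'`, `IsGalois F F'`, `IsTotallyReal F'` (finite
  over `F` because both are number fields), such that `r|_{Γ_{F'}} = r.restrictField F'` (restriction
  along the chosen `F̄ → F̄'`, up to conjugation) is `≅ r_{l,ı}(π)` for a RAESDC `(π, χ)` of
  `GL_n(𝔸_{F'})`, rendered — exactly as the accepted `Qian2022.IsAutomorphic` renders "`r ≅ r_{l,ι}(π)`"
  and as `CaraianiLeHung2016_thm_1_1` consumes it — by: `r.restrictField F'` is SEMISIMPLE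
  (`r_{l,ı}(π)` is "a continuous semi-simple representation", and semisimplicity is isomorphism
  invariant) and, for some cuspidal automorphic `π` of `GL_n(𝔸_{F'})` (`CuspidalAutomorphicRepData n F' hcpt`,
  the compactness fact `hcpt` being part of the existential — it is the proved
  `isCompact_glFiniteIntegralLevel_holds`) which is regular algebraic (`IsRegularAlgebraic`: "`π_∞`
  has the same infinitesimal character as some irreducible algebraic representation of
  `Res_{F'/ℚ} GL_n`", Clozel), `r.restrictField F'` has the published characterising property of
  `r_{l,ı}(π)` (`HarrisLanTaylorThorne2016.IsCompatible π ι _`: at every place over a rational prime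
  `q ≠ l` above which `π` is unramified, unramified with the Frobenius characteristic polynomial
  predicted by the Satake parameter in the normalisation `rec(π_v ⊗ |det|_v^{(1−n)/2})` — the SAME
  normalisation as Caraiani's local–global compatibility quoted above, of which it is the unramified
  case; isomorphism invariant).  DROPPED from the printed conclusion (weaker statement): the
  character `χ` and the essential self-duality of `π`, "of level prime to `l`" (Cor. 4.5.2), the
  linear disjointness from an auxiliary `F^{avoid}` (Thm. 4.5.1), and "Moreover `r` is part of a
  weakly compatible system" (the sibling `BLGGT2014_thm551_compatibleSystem_rat_GL4` over `ℚ`, `n = 4`).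
  -- TODO(general form): the CM case (Thm. 4.5.1: finite sets of `r_i`, `F'/F₀` Galois, `F^{avoid}`);
  -- the conclusion as a RAESDC pair `(π, χ)` of level prime to `l` with `r_{l,ı}(χ) ε_l^{1-n} = μ|`.

## References

* T. Barnet-Lamb, T. Gee, D. Geraghty, R. Taylor, Ann. of Math. 179 (2014) 501–609: Theorem C
  (Introduction; "Theorem 3" of arXiv:1010.2561, p. 4), Cor. 4.5.2 and Thm. 4.5.1 (pp. 30–31),
  §2.1 (pp. 17–18), Notation (p. 6), §1.4 (pp. 13–15). [BarnetlambEtAl2014]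
* T. Barnet-Lamb, D. Geraghty, M. Harris, R. Taylor, Publ. RIMS 47 (2011) 29–98, Lemma 1.5 (the
  descent from a CM quadratic extension in the proof of Cor. 4.5.2). [BarnetlambEtAl2011]
* A. Caraiani, Duke Math. J. 161 (2012) 2311–2413 (local–global compatibility at `v ∤ l`, the
  characterisation of `r_{l,ı}(π)` quoted from §2.1). [Caraiani2012]
* M. Harris, K.-W. Lan, R. Taylor, J. Thorne, Res. Math. Sci. 3:37 (2016), Thm. A (the tree's
  `HarrisLanTaylorThorne2016.IsCompatible`). [HarrisLanTaylorThorneRMS2016]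
-/

noncomputable section

open scoped MatrixGroups Matrix NumberField
open NumberField IsDedekindDomain Field Filter

namespace Literature.NumberTheory.Automorphic

open Literature.NumberTheory.GaloisRepresentations

/-- **Barnet-Lamb–Gee–Geraghty–Taylor 2014, Theorem C (= Cor. 4.5.2 / Thm. 4.5.1): potential
automorphy of a single `l`-adic representation over a totally real field.**  *Let `F` be totally
real, `n ≥ 1`, `l ≥ 2(n+1)` prime and `r : G_F → GL_n(ℚ̄_l)` continuous, such that (1) `r` is
unramified at all but finitely many primes; (2) either `r` maps to `GSp_n` with totally odd
multiplier or it maps to `GO(n)` with totally even multiplier; (3) `r` is potentially diagonalizable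
at each `v ∣ l` and has `n` distinct `τ`-Hodge–Tate numbers for each `τ : F ↪ ℚ̄_l`; (4)
`r̄|_{G_{F(ζ_l)}}` is irreducible.  Then there is a finite Galois totally real extension `F'/F` such
that `r|_{G_{F'}}` is automorphic.*  Rendered (module docstring, hypothesis by hypothesis): (2) on
matrices, `∃ J μ`, `Jᵀ = ∓J`, `det J` a unit, `r(g)ᵀ J r(g) = μ(g) J`, `μ(c) = ∓1` at every complex
conjugation; (3) over Fontaine's pinned datum `fontainePstAdicCompletion v l hv`: de Rham,
multiplicity-free labelled Hodge–Tate multisets of cardinality `n`, and potentially diagonalizable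
relative to every (existing) instance of compatible crystalline extension data — verbatim the clause
of `BLGGT2014_thm421_GL2_totallyReal`; (4) `IsResiduallyAbsIrreducible` of `r|_{Γ_{F(ζ_l)}}`;
conclusion, for the given `ι : ℚ̄_l ≃ ℂ` (§2.1 fixes an arbitrary `ı`): `r|_{Γ_{F'}}` is semisimple and
HLTT-compatible (`HarrisLanTaylorThorne2016.IsCompatible`, the characterising property of
`r_{l,ı}(π)`) with a regular algebraic cuspidal `π` of `GL_n(𝔸_{F'})` — the hypothesis consumed by
`CaraianiLeHung2016_thm_1_1`.  Dropped (weaker than print): `χ`, self-duality and level of `π`, and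
"`r` is part of a weakly compatible system".  Named fact (D-0014); users take
`(h : BLGGT2014_thmC_potentialAutomorphy)`.
-- TODO(general form): the CM case of Thm. 4.5.1 (finite families, `F^{avoid}`), and the conclusion
-- as a RAESDC pair of level prime to `l`.
[cite: BarnetlambEtAl2014, Theorem C (= Cor. 4.5.2, Thm. 4.5.1) with §2.1 and §1.4] -/
def BLGGT2014_thmC_potentialAutomorphy : Prop :=
  ∀ (F : Type) [Field F] [NumberField F], IsTotallyReal F →
    ∀ (n : ℕ), 0 < n → ∀ (l : ℕ) [Fact l.Prime], 2 * (n + 1) ≤ l →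
    ∀ (ι : PadicAlgCl l ≃+* ℂ) (r : FramedGaloisRep F (PadicAlgCl l) n),
      -- (1) `r` is unramified at all but finitely many primes
      (∀ᶠ v : HeightOneSpectrum (𝓞 F) in cofinite, r.IsUnramifiedAt v) →
      -- (2) odd essential self-duality: `GSp_n` with totally odd multiplier, or `GO_n` with
      -- totally even multiplier
      ((∃ (J : Matrix (Fin n) (Fin n) (PadicAlgCl l)) (μ : absoluteGaloisGroup F →* (PadicAlgCl l)ˣ),
          Jᵀ = -J ∧ IsUnit J.det ∧
          (∀ g : absoluteGaloisGroup F, (r g).val.transpose * J * (r g).val = (μ g : PadicAlgCl l) • J) ∧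
          ∀ (φ : F →+* ℝ) (c : absoluteGaloisGroup F), IsComplexConjugation φ c → μ c = -1) ∨
        (∃ (J : Matrix (Fin n) (Fin n) (PadicAlgCl l)) (μ : absoluteGaloisGroup F →* (PadicAlgCl l)ˣ),
          J.IsSymm ∧ IsUnit J.det ∧
          (∀ g : absoluteGaloisGroup F, (r g).val.transpose * J * (r g).val = (μ g : PadicAlgCl l) • J) ∧
          ∀ (φ : F →+* ℝ) (c : absoluteGaloisGroup F), IsComplexConjugation φ c → μ c = 1)) →
      -- (3) at every `v ∣ l`, for Fontaine's pinned datum: de Rham, `n` distinct `τ`-labelled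
      -- Hodge–Tate numbers for every label `τ`, potentially diagonalizable for every (existing)
      -- instance of compatible crystalline extension data
      (∀ (v : HeightOneSpectrum (𝓞 F)) (hv : ((l : ℕ) : 𝓞 F) ∈ v.asIdeal),
        (PAdicHodge.fontainePstAdicCompletion v l hv).IsDeRhamFramed (r.toLocal v) ∧
        (letI := (PAdicHodge.fontainePstAdicCompletion v l hv).algebra
         (∀ τ : v.adicCompletion F →ₐ[ℚ_[l]] PadicAlgCl l,
            (let M := r.labelledHodgeTateWeightsAt v
               (PAdicHodge.fontainePstAdicCompletion v l hv).algebra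
               (PAdicHodge.fontainePstAdicCompletion v l hv).𝔅 τ.toRingHom
             M.Nodup ∧ Multiset.card M = n)) ∧
         Nonempty (PstCrystallineExtensionData (PAdicHodge.fontainePstAdicCompletion v l hv)) ∧
         ∀ 𝔈 : PstCrystallineExtensionData (PAdicHodge.fontainePstAdicCompletion v l hv),
           IsPotentiallyDiagonalizable 𝔈.𝔅 (r.toLocal v))) →
      -- (4) `r̄|_{Γ_{F(ζ_l)}}` is (absolutely) irreducible
      (r.restrictField (CyclotomicField l F)).IsResiduallyAbsIrreducible →
      -- CONCLUSION: `r|_{Γ_{F'}} ≅ r_{l,ı}(π)` over a finite Galois totally real `F'/F`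
      ∃ (F' : Type) (_ : Field F') (_ : NumberField F') (_ : Algebra F F'),
        IsGalois F F' ∧ IsTotallyReal F' ∧
          (r.restrictField F').toGaloisRep.IsSemisimple ∧
          ∃ (hcpt : isCompact_glFiniteIntegralLevel n F') (π : CuspidalAutomorphicRepData n F' hcpt),
            π.1.IsRegularAlgebraic ∧ HarrisLanTaylorThorne2016.IsCompatible π.1 ι (r.restrictField F')

/-- **Projection of `BLGGT2014_thmC_potentialAutomorphy` onto the shape of the requesting stub**
(`stub_traceComplexConjugation` of `stmt-Langlands-17009`): base field `ℚ` (Mathlib instance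
`IsTotallyReal ℚ`), the `GO_n` alternative with totally even multiplier, and the local clause at
`v ∣ l` with `r|_{Γ_{ℚ_v}}` CRYSTALLINE for the pinned datum (crystalline ⇒ de Rham,
`IsCrystallineFramed.isDeRhamFramed`) and the non-vacuity witness
`Nonempty (PstCrystallineExtensionData _)` supplied separately (e.g. by
`nonempty_pstCrystallineExtensionData_fontainePstAdicCompletion` under `FontaineDatumExists`).
Nothing but bookkeeping. [folklore] -/
theorem BLGGT2014_thmC_potentialAutomorphy.rat_GO_even (h : BLGGT2014_thmC_potentialAutomorphy)
    {n : ℕ} (hn : 0 < n) {l : ℕ} [Fact l.Prime] (hl : 2 * (n + 1) ≤ l) (ι : PadicAlgCl l ≃+* ℂ)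
    (r : FramedGaloisRep ℚ (PadicAlgCl l) n)
    (hunr : ∀ᶠ v : HeightOneSpectrum (𝓞 ℚ) in cofinite, r.IsUnramifiedAt v)
    (hGO : ∃ (J : Matrix (Fin n) (Fin n) (PadicAlgCl l)) (μ : absoluteGaloisGroup ℚ →* (PadicAlgCl l)ˣ),
        J.IsSymm ∧ IsUnit J.det ∧
        (∀ g : absoluteGaloisGroup ℚ, (r g).val.transpose * J * (r g).val = (μ g : PadicAlgCl l) • J) ∧
        ∀ (φ : ℚ →+* ℝ) (c : absoluteGaloisGroup ℚ), IsComplexConjugation φ c → μ c = 1)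
    (hloc : ∀ (v : HeightOneSpectrum (𝓞 ℚ)) (hv : ((l : ℕ) : 𝓞 ℚ) ∈ v.asIdeal),
        (PAdicHodge.fontainePstAdicCompletion v l hv).IsCrystallineFramed (r.toLocal v) ∧
        (letI := (PAdicHodge.fontainePstAdicCompletion v l hv).algebra
         (∀ τ : v.adicCompletion ℚ →ₐ[ℚ_[l]] PadicAlgCl l,
            (let M := r.labelledHodgeTateWeightsAt v
               (PAdicHodge.fontainePstAdicCompletion v l hv).algebra
               (PAdicHodge.fontainePstAdicCompletion v l hv).𝔅 τ.toRingHom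
             M.Nodup ∧ Multiset.card M = n)) ∧
         ∀ 𝔈 : PstCrystallineExtensionData (PAdicHodge.fontainePstAdicCompletion v l hv),
           IsPotentiallyDiagonalizable 𝔈.𝔅 (r.toLocal v)))
    (hne : ∀ (v : HeightOneSpectrum (𝓞 ℚ)) (hv : ((l : ℕ) : 𝓞 ℚ) ∈ v.asIdeal),
        Nonempty (PstCrystallineExtensionData (PAdicHodge.fontainePstAdicCompletion v l hv)))
    (hirr : (r.restrictField (CyclotomicField l ℚ)).IsResiduallyAbsIrreducible) :
    ∃ (F' : Type) (_ : Field F') (_ : NumberField F') (_ : Algebra ℚ F'),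
      IsGalois ℚ F' ∧ IsTotallyReal F' ∧
        (r.restrictField F').toGaloisRep.IsSemisimple ∧
        ∃ (hcpt : isCompact_glFiniteIntegralLevel n F') (π : CuspidalAutomorphicRepData n F' hcpt),
          π.1.IsRegularAlgebraic ∧ HarrisLanTaylorThorne2016.IsCompatible π.1 ι (r.restrictField F') :=
  h ℚ inferInstance n hn l hl ι r hunr (Or.inr hGO)
    (fun v hv => ⟨(hloc v hv).1.isDeRhamFramed, (hloc v hv).2.1, hne v hv, (hloc v hv).2.2⟩) hirr

end Literature.NumberTheory.Automorphic

end
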